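import Summits.Ventures.YMGap.RobustBall.LangevinPoincareDLR
import Summits.Ventures.YMGap.RobustBall.LoopObservable
import Summits.Ventures.YMGap.RobustBall.RectangleTrail
import Summits.Ventures.YMGap.Thresholds.SharpLargeNLoops
import Summits.Ventures.YMGap.Thresholds.LatticeBakryEmeryLipschitz
import Literature.MathematicalPhysics.QuantumFieldTheory.Balaban1983to89.StrongCouplingKernelWindow
import HarnessLib

/-!
# Robust ball (Y2) — 'T HOOFT SCALING OF WILSON-LOOP FLUCTUATIONS IN EVERY GIBBS STATE: `Var_μ((1/N) Re tr U_C) ≤ ((1 − c)K₀)⁻¹ · |C|/N` for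
# every closed lattice trail `C` (every rectangle: `2(R+T)/N`) of strong-coupling `SU(N)` lattice Yang–Mills, Kantorovich–Rubinstein window

HONEST FRAMING: venture file of the cell `pub-ymgap` (QuantumFields programme), track ROBUST-BALL, seat rb-p2 (g16); a corollary of
`LangevinPoincareDLR.gibbs_variance_le_integral_Gam_of_oneLinkKRModulus` (g14: gradient-form Poincaré inequality of EVERY DLR state), the frame bound
`Γ(u,u) ≤ ∑_e L_e²` (`LatticeBakryEmery.Gam_le_of_linkLipschitz`), rb-p1's one-link telescoping of walk holonomies with MULTIPLICITIES
(`suFrobDist_walkHolonomy_le_dartMult`) and rb-p1's «a rectangle is a closed trail» (`isTrail_rectWalk`).  LATTICE statements at STRONG COUPLING, Wilson action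
(class K); nothing about `β → ∞`, the continuum or Clay.

THE STATEMENTS ('t Hooft coupling `β`, bare `Nβ`; `2(d−1)|β| ≤ R`, `OneLinkKRModulus N R K`, `c := 6(d−1)|β|K < 1`, `K₀ := N/2 − 2(d−1)N|β| > 0`, `A := ((1−c)K₀)⁻¹`;
`W_C := (1/N) Re tr hol_C(U)` = tree `wilsonLoopObs (fun g => N⁻¹ Re tr g) C`; `μ` ANY DLR state):
* `gibbs_variance_le_of_Gam_le` — the sup form of the clause: `Γ(f,f) ≤ B` on `SU(N)^Δ` ⇒ `Var_μ(f((U_e)_{e∈Δ})) ≤ A·B`.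
* ★ `pathFun_darts_linkLipschitz` — the normalised trace of the holonomy of a walk `w` is `(√N)⁻¹ mult_w(e)`-Lipschitz in the link `e` (Frobenius distance),
  `mult_w(e)` = rb-p1's `dartMult w e` = number of darts of `w` over `e` (the tree's `pathFun_lipschitz` carries `|w|/√N` at every link).
* ★★ `gibbs_variance_wilsonLoop_le_of_oneLinkKRModulus` — for EVERY DLR state and every closed walk `C`: `Var_μ(W_C) ≤ A · N⁻¹ ∑_{e ∈ links(C)} mult_C(e)²`;
  ★★ `gibbs_variance_wilsonLoop_le_of_isTrail` — for a closed TRAIL (no link twice): `Var_μ(W_C) ≤ A · |C|/N`; ★★ `gibbs_variance_rectangle_le_of_oneLinkKRModulus` —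
  the `R × T` rectangle (`i ≠ j`, `R, T ≥ 1`): `Var_μ(W_{R×T}) ≤ A · 2(R+T)/N`.  At fixed 't Hooft coupling `A = O(1/N)`, so these are `O(|C|/N²)`: 'T HOOFT SCALING of
  Wilson-loop fluctuations in every Gibbs state, growing only with the PERIMETER (Shen–Zhu–Zhu Cor. 1.5 prints `Var(W_C) ≤ 4n(n−3)/(K_S N)` for the infinite-volume limit
  state on the Bakry–Émery window `1/(16(d−1))`; tree `SharpLargeNFree.path_variance_sharp_free`: `|Λ| n²/(NK)` for limit points on `|β| < 1/(8d)`).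
  Cells: ★ `su2_gibbs_variance_rectangle_le` — `SU(2)`, `d = 4`, `0 ≤ β_W < 2/9`, every DLR state: `Var_μ(W_{R×T}) ≤ (R + T)/((1 − 9β_W/2)(1 − 3β_W))`;
  ★ `suN_gibbs_variance_rectangle_le_bakryEmery` — every `N ≥ 2`, `d = 4`, `0 ≤ b < 1/48`: `Var_μ(W_{R×T}) ≤ 2(R + T)/(N²(1/2 − 24b))`.
MECHANISM: the word `(1/N) Re tr Π_k U_{e_k}^{±1}` over the darts of `w` is a smooth cylinder function (`HessianSharp.pathFun`, `matrixCylinder_pathFun_walk`); extending a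
link family on `Λ ⊇ links(w)` by `1` off `Λ` gives a configuration whose holonomy has the same trace, so rb-p1's configuration-level telescoping bound with
multiplicities applies; `|Re tr X| ≤ √N ‖X‖_F`; then `Γ ≤ ∑_e L_e² = N⁻¹ ∑_e mult²` and the Gibbs-state Langevin Poincaré inequality; for trails `mult ≤ 1`
(`isTrail_iff_nodup_dartSteps`, `List.nodup_iff_count_le_one`) and `∑_e mult_w(e) = |w|` (`sum_walkEdges_dartMult`).  0 sorry, 0 definitions.  References: H. Shen,
R. Zhu, X. Zhu, CMP 400 (2023) 805–851, Cor. 1.5; S. Chatterjee, Probab. Theory Relat. Fields 175 (2019) (loop observables at large `N`, for comparison).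
Everything here is proved. [folklore]
-/

noncomputable section

open scoped Matrix ComplexConjugate BigOperators Matrix.Norms.Frobenius ContDiff Topology ProbabilityTheory NNReal
open Matrix Complex Finset MeasureTheory Filter ProbabilityTheory Function Real SimpleGraph
open Literature.Probability.LatticeModels Literature.Probability.LatticeModels.DobrushinMetric
open Literature.MathematicalPhysics.QuantumLattice hiding torusNorm
open Literature.MathematicalPhysics.QuantumFieldTheory hiding ZdEdge Site
open Literature.MathematicalPhysics.QuantumFieldTheory.SUNBakryEmery (SUN FrameIdx frame)
open Literature.MathematicalPhysics.QuantumFieldTheory.Balaban1983to89.StrongCouplingDobrushinWindow (OneLinkKRModulus)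
open Summit.Ventures.YMGap.LatticeBakryEmery
open Summit.Ventures.YMGap.HessianSharp (pathFun pathFun_lipschitz contDiff_pathFun matrixCylinder_pathFun_walk)

namespace Summit.Ventures.YMGap.RobustBall.LangevinPoincare

variable {d N : ℕ}

/-! ### The sup form of the Lipschitz clause -/

section Clause

/-- **The sup-`Γ` clause of the Gibbs-state Langevin Poincaré inequality**: under the window hypotheses, if `Γ(f,f) ≤ B` at every `SU(N)` link family over `Δ`,
then `Var_μ(f((U_e)_{e∈Δ})) ≤ ((1 − c)K₀)⁻¹ · B` for EVERY DLR state `μ`. [folklore] -/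
theorem gibbs_variance_le_of_Gam_le (hd : 1 ≤ d) (hN : 1 ≤ N) {β R K c : ℝ} (hK : 0 ≤ K)
    (hR : |β| * (2 * ((d : ℝ) - 1)) ≤ R) (hmod : OneLinkKRModulus N R K) (hc : 6 * ((d : ℝ) - 1) * |β| * K ≤ c) (hc1 : c < 1)
    (hK₀ : 0 < (N : ℝ) / 2 - N * |β| * (2 * ((d : ℝ) - 1)))
    {μ : Measure (LGConfig d (SUN N))} (hμ : μ ∈ ymGibbsMeasures (d := d) (fundamentalRep (Fin N)) ((N : ℝ) * β))
    (Δ : Finset (ZdEdge d)) {f : Cfg ↥Δ N → ℝ} (hf : ContDiff ℝ ∞ f) {B : ℝ} (hB : ∀ g : PSU ↥Δ N, Gam f f (emb g) ≤ B) :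
    Var[matrixCylinder Δ f; μ] ≤ ((1 - c) * ((N : ℝ) / 2 - N * |β| * (2 * ((d : ℝ) - 1))))⁻¹ * B := by
  have hμ' : IsGibbsMeasure (ymSpecification (d := d) (fundamentalRep (Fin N)) ((N : ℝ) * β)) μ := hμ
  haveI := hμ'.isProbabilityMeasure
  have key := gibbs_variance_le_integral_Gam_of_oneLinkKRModulus hd hN hK hR hmod hc hc1 hK₀ hμ Δ hf
  have hpt : ∀ U : LGConfig d (SUN N), Gam f f (fun e : ↥Δ => (U e : Matrix (Fin N) (Fin N) ℂ)) ≤ B := fun U => hB fun e : ↥Δ => U e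
  have hint : ∫ U, Gam f f (fun e : ↥Δ => (U e : Matrix (Fin N) (Fin N) ℂ)) ∂μ ≤ B := by
    calc ∫ U, Gam f f (fun e : ↥Δ => (U e : Matrix (Fin N) (Fin N) ℂ)) ∂μ ≤ ∫ _U, B ∂μ :=
          integral_mono_of_nonneg (ae_of_all _ fun U => Gam_self_nonneg _ _) (integrable_const _) (ae_of_all _ hpt)
      _ = B := by simp
  exact key.trans (mul_le_mul_of_nonneg_left hint (inv_nonneg.2 (mul_pos (by linarith) hK₀).le))

end Clause

/-! ### The holonomy trace of a walk is `(√N)⁻¹·mult`-Lipschitz in each link -/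

section Walk

/-- **Per-link Lipschitz constants of the normalised holonomy trace of a walk, with multiplicities**: if the links under the darts of `w` lie in `Λ`, the
cylinder function `(1/N) Re tr Π_{darts} U^{±1}` (`pathFun Λ (darts ↦ dartStep)`) is `(√N)⁻¹·mult_w(e)`-Lipschitz in the link `e` for the Frobenius distance,
`mult_w(e) = dartMult w e`. [folklore] -/
theorem pathFun_darts_linkLipschitz (hN : 1 ≤ N) {x y : Site d} (w : (zdGraph d).Walk x y) (Λ : Finset (ZdEdge d))
    (hΛ : ∀ a ∈ w.darts, (dartStep a).1 ∈ Λ) :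
    LinkLipschitz (pathFun (N := N) Λ (w.darts.map dartStep)) fun e => (Real.sqrt N)⁻¹ * (dartMult w (e : ZdEdge d) : ℝ) := by
  classical
  intro e₀ M M' h
  change |pathFun (N := N) Λ (w.darts.map dartStep) (fun e => (M e : Matrix (Fin N) (Fin N) ℂ)) -
      pathFun (N := N) Λ (w.darts.map dartStep) (fun e => (M' e : Matrix (Fin N) (Fin N) ℂ))| ≤
    (Real.sqrt N)⁻¹ * (dartMult w (e₀ : ZdEdge d) : ℝ) * suFrobDist (M e₀) (M' e₀)
  have hN0 : (0 : ℝ) < N := by exact_mod_cast hN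
  have hsq : (0 : ℝ) < Real.sqrt N := Real.sqrt_pos.2 hN0
  -- extend the link families to configurations (by `1` off `Λ`)
  set U : LGConfig d (SUN N) := fun e => if he : e ∈ Λ then M ⟨e, he⟩ else 1 with hU
  set U' : LGConfig d (SUN N) := fun e => if he : e ∈ Λ then M' ⟨e, he⟩ else 1 with hU'
  have hUM : (fun e : ↥Λ => ((U e : SUN N) : Matrix (Fin N) (Fin N) ℂ)) = fun e => (M e : Matrix (Fin N) (Fin N) ℂ) := by
    funext e; simp only [hU, dif_pos e.2]
  have hUM' : (fun e : ↥Λ => ((U' e : SUN N) : Matrix (Fin N) (Fin N) ℂ)) = fun e => (M' e : Matrix (Fin N) (Fin N) ℂ) := by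
    funext e; simp only [hU', dif_pos e.2]
  have h1 : pathFun (N := N) Λ (w.darts.map dartStep) (fun e => (M e : Matrix (Fin N) (Fin N) ℂ)) =
      (N : ℝ)⁻¹ * ((walkHolonomy U w : SUN N) : Matrix (Fin N) (Fin N) ℂ).trace.re := by
    rw [← hUM]; exact matrixCylinder_pathFun_walk w Λ hΛ U
  have h2 : pathFun (N := N) Λ (w.darts.map dartStep) (fun e => (M' e : Matrix (Fin N) (Fin N) ℂ)) =
      (N : ℝ)⁻¹ * ((walkHolonomy U' w : SUN N) : Matrix (Fin N) (Fin N) ℂ).trace.re := by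
    rw [← hUM']; exact matrixCylinder_pathFun_walk w Λ hΛ U'
  -- the configurations agree off `e₀`
  have hagree : ∀ z, z ≠ (e₀ : ZdEdge d) → U z = U' z := by
    intro z hz
    simp only [hU, hU']
    split_ifs with hzΛ
    · exact h ⟨z, hzΛ⟩ fun h' => hz (congrArg Subtype.val h')
    · rfl
  have hhol := suFrobDist_walkHolonomy_le_dartMult w (U := U) (V := U') hagree
  have hUe : U (e₀ : ZdEdge d) = M e₀ := by simp only [hU, dif_pos e₀.2]
  have hUe' : U' (e₀ : ZdEdge d) = M' e₀ := by simp only [hU', dif_pos e₀.2]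
  rw [hUe, hUe'] at hhol
  -- the trace of the difference
  set P : Matrix (Fin N) (Fin N) ℂ := ((walkHolonomy U w : SUN N) : Matrix (Fin N) (Fin N) ℂ) with hP
  set Q : Matrix (Fin N) (Fin N) ℂ := ((walkHolonomy U' w : SUN N) : Matrix (Fin N) (Fin N) ℂ) with hQ
  have h1u : (1 : Matrix (Fin N) (Fin N) ℂ) ∈ Matrix.unitaryGroup (Fin N) ℂ := Submonoid.one_mem _
  have htr : |((P - Q) * 1).trace.re| ≤ frobNorm (P - Q) * Real.sqrt N := by
    refine (abs_re_trace_mul_le _ _).trans (le_of_eq ?_)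
    rw [← Real.sqrt_sq (frobNorm_nonneg (1 : Matrix (Fin N) (Fin N) ℂ)), frobNorm_sq_of_mem_unitaryGroup h1u, Fintype.card_fin]
  rw [Matrix.mul_one] at htr
  have hdist : frobNorm (P - Q) = suFrobDist (walkHolonomy U w) (walkHolonomy U' w) := rfl
  rw [h1, h2, ← mul_sub, abs_mul, abs_of_pos (inv_pos.2 hN0), show P.trace.re - Q.trace.re = (P - Q).trace.re by
    rw [trace_sub, Complex.sub_re]]
  have hNsq : (N : ℝ)⁻¹ * Real.sqrt N = (Real.sqrt N)⁻¹ := by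
    nth_rw 1 [← Real.mul_self_sqrt hN0.le]
    rw [mul_inv, mul_assoc, inv_mul_cancel₀ hsq.ne', mul_one]
  calc (N : ℝ)⁻¹ * |(P - Q).trace.re| ≤ (N : ℝ)⁻¹ * (frobNorm (P - Q) * Real.sqrt N) := mul_le_mul_of_nonneg_left htr (inv_nonneg.2 hN0.le)
    _ ≤ (N : ℝ)⁻¹ * ((dartMult w (e₀ : ZdEdge d) : ℝ) * suFrobDist (M e₀) (M' e₀) * Real.sqrt N) := by
        rw [hdist]; exact mul_le_mul_of_nonneg_left (mul_le_mul_of_nonneg_right hhol (Real.sqrt_nonneg _)) (inv_nonneg.2 hN0.le)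
    _ = (Real.sqrt N)⁻¹ * (dartMult w (e₀ : ZdEdge d) : ℝ) * suFrobDist (M e₀) (M' e₀) := by rw [← hNsq]; ring

/-- Dictionary: on `SU(N)` configurations the cylinder function of the darts of a closed walk `C` over `Λ = links(C)` is the normalised Wilson loop
`W_C = (1/N) Re tr hol_C` (tree `wilsonLoopObs`). [folklore] -/
theorem matrixCylinder_pathFun_eq_wilsonLoopObs {x : Site d} (w : (zdGraph d).Walk x x) (U : LGConfig d (SUN N)) :
    matrixCylinder (walkEdges w) (pathFun (walkEdges w) (w.darts.map dartStep)) U =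
      wilsonLoopObs (fun g : SUN N => (N : ℝ)⁻¹ * (g : Matrix (Fin N) (Fin N) ℂ).trace.re) w U := by
  have hΛ : ∀ a ∈ w.darts, (dartStep a).1 ∈ walkEdges w := fun a ha => by
    unfold walkEdges; rw [List.mem_toFinset, List.mem_map]; exact ⟨a, ha, rfl⟩
  rw [matrixCylinder_pathFun_walk w (walkEdges w) hΛ U]
  rfl

end Walk

/-! ### The variance of Wilson loops in every Gibbs state -/

section Gibbs

/-- ★★ **WILSON-LOOP VARIANCE WITH MULTIPLICITIES IN EVERY GIBBS STATE**: under the window hypotheses, for every DLR state `μ` and every closed lattice walk `C`,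
`Var_μ(W_C) ≤ ((1 − c)K₀)⁻¹ · N⁻¹ ∑_{e ∈ links(C)} mult_C(e)²`. [folklore] -/
theorem gibbs_variance_wilsonLoop_le_of_oneLinkKRModulus (hd : 1 ≤ d) (hN : 1 ≤ N) {β R K c : ℝ} (hK : 0 ≤ K)
    (hR : |β| * (2 * ((d : ℝ) - 1)) ≤ R) (hmod : OneLinkKRModulus N R K) (hc : 6 * ((d : ℝ) - 1) * |β| * K ≤ c) (hc1 : c < 1)
    (hK₀ : 0 < (N : ℝ) / 2 - N * |β| * (2 * ((d : ℝ) - 1)))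
    {μ : Measure (LGConfig d (SUN N))} (hμ : μ ∈ ymGibbsMeasures (d := d) (fundamentalRep (Fin N)) ((N : ℝ) * β))
    {x : Site d} (w : (zdGraph d).Walk x x) :
    Var[wilsonLoopObs (fun g : SUN N => (N : ℝ)⁻¹ * (g : Matrix (Fin N) (Fin N) ℂ).trace.re) w; μ] ≤
      ((1 - c) * ((N : ℝ) / 2 - N * |β| * (2 * ((d : ℝ) - 1))))⁻¹ * ((N : ℝ)⁻¹ * ∑ e ∈ walkEdges w, (dartMult w e : ℝ) ^ 2) := by
  classical
  have hN0 : (0 : ℝ) < N := by exact_mod_cast hN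
  have hΛ : ∀ a ∈ w.darts, (dartStep a).1 ∈ walkEdges w := fun a ha => by
    unfold walkEdges; rw [List.mem_toFinset, List.mem_map]; exact ⟨a, ha, rfl⟩
  have hLip := pathFun_darts_linkLipschitz hN w (walkEdges w) hΛ
  have hB : ∀ g : PSU ↥(walkEdges w) N, Gam (pathFun (N := N) (walkEdges w) (w.darts.map dartStep)) (pathFun (walkEdges w) (w.darts.map dartStep)) (emb g) ≤
      ∑ e : ↥(walkEdges w), ((Real.sqrt N)⁻¹ * (dartMult w (e : ZdEdge d) : ℝ)) ^ 2 := fun g =>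
    Gam_le_of_linkLipschitz (by omega) (contDiff_pathFun _ _) (fun _ => by positivity) hLip g
  have key := gibbs_variance_le_of_Gam_le hd hN hK hR hmod hc hc1 hK₀ hμ (walkEdges w) (contDiff_pathFun _ _) hB
  have hfun : matrixCylinder (walkEdges w) (pathFun (N := N) (walkEdges w) (w.darts.map dartStep)) =
      wilsonLoopObs (fun g : SUN N => (N : ℝ)⁻¹ * (g : Matrix (Fin N) (Fin N) ℂ).trace.re) w := funext (matrixCylinder_pathFun_eq_wilsonLoopObs w)
  rw [hfun] at key
  refine key.trans (le_of_eq ?_)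
  congr 1
  rw [sum_coe_sort (walkEdges w) (fun e => ((Real.sqrt N)⁻¹ * (dartMult w e : ℝ)) ^ 2), mul_sum]
  refine sum_congr rfl fun e _ => ?_
  rw [mul_pow, inv_pow, Real.sq_sqrt hN0.le]

/-- ★★ **CLOSED TRAILS: `Var_μ(W_C) ≤ ((1 − c)K₀)⁻¹ · |C|/N`** — a closed walk traversing no link twice has all multiplicities `1`, so the bound grows with the
PERIMETER `|C|` only; `O(|C|/N²)` at fixed 't Hooft coupling. [folklore] -/
theorem gibbs_variance_wilsonLoop_le_of_isTrail (hd : 1 ≤ d) (hN : 1 ≤ N) {β R K c : ℝ} (hK : 0 ≤ K)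
    (hR : |β| * (2 * ((d : ℝ) - 1)) ≤ R) (hmod : OneLinkKRModulus N R K) (hc : 6 * ((d : ℝ) - 1) * |β| * K ≤ c) (hc1 : c < 1)
    (hK₀ : 0 < (N : ℝ) / 2 - N * |β| * (2 * ((d : ℝ) - 1)))
    {μ : Measure (LGConfig d (SUN N))} (hμ : μ ∈ ymGibbsMeasures (d := d) (fundamentalRep (Fin N)) ((N : ℝ) * β))
    {x : Site d} {w : (zdGraph d).Walk x x} (hw : w.IsTrail) :
    Var[wilsonLoopObs (fun g : SUN N => (N : ℝ)⁻¹ * (g : Matrix (Fin N) (Fin N) ℂ).trace.re) w; μ] ≤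
      ((1 - c) * ((N : ℝ) / 2 - N * |β| * (2 * ((d : ℝ) - 1))))⁻¹ * ((w.length : ℝ) / N) := by
  classical
  have key := gibbs_variance_wilsonLoop_le_of_oneLinkKRModulus hd hN hK hR hmod hc hc1 hK₀ hμ w
  -- on a trail every multiplicity is `≤ 1`, hence `mult² = mult`, and the multiplicities sum to the length
  have hnd := (isTrail_iff_nodup_dartSteps w).1 hw
  have hle : ∀ e, dartMult w e ≤ 1 := fun e =>
    (@List.nodup_iff_count_le_one (ZdEdge d) instBEqOfDecidableEq _ _).1 hnd e
  have hsq : ∀ e ∈ walkEdges w, ((dartMult w e : ℝ)) ^ 2 = (dartMult w e : ℝ) := fun e _ => by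
    have h1 := hle e
    interval_cases h : dartMult w e <;> simp
  have hsum : ∑ e ∈ walkEdges w, (dartMult w e : ℝ) ^ 2 = w.length := by
    rw [sum_congr rfl hsq, ← Nat.cast_sum, sum_walkEdges_dartMult]
  rw [hsum] at key
  refine key.trans (le_of_eq ?_)
  rw [div_eq_inv_mul (w.length : ℝ) (N : ℝ)]

/-- ★★ **RECTANGLES: `Var_μ(W_{R×T}) ≤ ((1 − c)K₀)⁻¹ · 2(R + T)/N`** for every DLR state `μ`, every base point `x`, directions `i ≠ j` and `R, T ≥ 1` (a rectangle is a
closed trail of length `2(R+T)`, rb-p1's `isTrail_rectWalk`). [folklore] -/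
theorem gibbs_variance_rectangle_le_of_oneLinkKRModulus (hd : 1 ≤ d) (hN : 1 ≤ N) {β R K c : ℝ} (hK : 0 ≤ K)
    (hR : |β| * (2 * ((d : ℝ) - 1)) ≤ R) (hmod : OneLinkKRModulus N R K) (hc : 6 * ((d : ℝ) - 1) * |β| * K ≤ c) (hc1 : c < 1)
    (hK₀ : 0 < (N : ℝ) / 2 - N * |β| * (2 * ((d : ℝ) - 1)))
    {μ : Measure (LGConfig d (SUN N))} (hμ : μ ∈ ymGibbsMeasures (d := d) (fundamentalRep (Fin N)) ((N : ℝ) * β))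
    (x : Site d) {i j : Fin d} (hij : i ≠ j) {Rl Tl : ℕ} (hRl : 1 ≤ Rl) (hTl : 1 ≤ Tl) :
    Var[wilsonLoopObs (fun g : SUN N => (N : ℝ)⁻¹ * (g : Matrix (Fin N) (Fin N) ℂ).trace.re) (rectWalk x i j Rl Tl); μ] ≤
      ((1 - c) * ((N : ℝ) / 2 - N * |β| * (2 * ((d : ℝ) - 1))))⁻¹ * (2 * ((Rl : ℝ) + Tl) / N) := by
  have key := gibbs_variance_wilsonLoop_le_of_isTrail hd hN hK hR hmod hc hc1 hK₀ hμ (isTrail_rectWalk x hij hRl hTl)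
  rw [length_rectWalk] at key
  push_cast at key
  exact key

end Gibbs

/-! ### Cells -/

section Cells

/-- ★ **`SU(2)`, `d = 4`, HYPOTHESIS-FREE on `0 ≤ β_W < 2/9`** (tree coupling `β_W/2`; `W = ½ Re tr`): for every DLR state `μ` and every lattice rectangle (`i ≠ j`,
`R, T ≥ 1`), `Var_μ(W_{R×T}) ≤ (R + T)/((1 − 9β_W/2)(1 − 3β_W))`. [folklore] -/
theorem su2_gibbs_variance_rectangle_le {βW : ℝ} (h0 : 0 ≤ βW) (h : βW < 2 / 9)
    {μ : Measure (LGConfig 4 (SUN 2))} (hμ : μ ∈ ymGibbsMeasures (d := 4) (fundamentalRep (Fin 2)) (βW / 2))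
    (x : Site 4) {i j : Fin 4} (hij : i ≠ j) {Rl Tl : ℕ} (hRl : 1 ≤ Rl) (hTl : 1 ≤ Tl) :
    Var[wilsonLoopObs (fun g : SUN 2 => ((2 : ℕ) : ℝ)⁻¹ * (g : Matrix (Fin 2) (Fin 2) ℂ).trace.re) (rectWalk x i j Rl Tl); μ] ≤
      ((Rl : ℝ) + Tl) / ((1 - 9 * βW / 2) * (1 - 3 * βW)) := by
  have hβ : ((2 : ℕ) : ℝ) * (βW / 4) = βW / 2 := by push_cast; ring
  have habs : |βW / 4| = βW / 4 := abs_of_nonneg (by positivity)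
  have hμ4 : μ ∈ ymGibbsMeasures (d := 4) (fundamentalRep (Fin 2)) (((2 : ℕ) : ℝ) * (βW / 4)) := by rwa [hβ]
  have key := gibbs_variance_rectangle_le_of_oneLinkKRModulus (d := 4) (N := 2) (by norm_num) (by norm_num) (β := βW / 4) zero_le_one
    (R := 3 * βW / 2) (by rw [habs]; norm_num; linarith) (SlabAreaLawDimensions.su2_oneLinkKRModulus_of_le_one (by linarith))
    (c := 9 * βW / 2) (by rw [habs]; norm_num; linarith) (by linarith) (by rw [habs]; norm_num; linarith) hμ4 x hij hRl hTl
  have e : (1 - 9 * βW / 2) * (((2 : ℕ) : ℝ) / 2 - (2 : ℕ) * |βW / 4| * (2 * (((4 : ℕ) : ℝ) - 1))) = (1 - 9 * βW / 2) * (1 - 3 * βW) := by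
    rw [habs]; push_cast; ring
  rw [e] at key
  refine key.trans (le_of_eq ?_)
  push_cast
  rw [inv_mul_eq_div, div_div]
  exact mul_div_mul_left _ _ two_ne_zero

/-- ★ **EVERY `SU(N)`, `N ≥ 2`, `d = 4`, HYPOTHESIS-FREE on 't Hooft `0 ≤ b < 1/48`** (bare `Nb`, Bakry–Émery one-link modulus): for every DLR state `μ` and every
lattice rectangle, `Var_μ(W_{R×T}) ≤ 2(R + T)/(N²(1/2 − 24b))` — 't Hooft scaling of Wilson-loop fluctuations, perimeter growth. [folklore] -/
theorem suN_gibbs_variance_rectangle_le_bakryEmery (hN : 2 ≤ N) {b : ℝ} (hb0 : 0 ≤ b) (hb : b < 1 / 48)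
    {μ : Measure (LGConfig 4 (SUN N))} (hμ : μ ∈ ymGibbsMeasures (d := 4) (fundamentalRep (Fin N)) ((N : ℝ) * b))
    (x : Site 4) {i j : Fin 4} (hij : i ≠ j) {Rl Tl : ℕ} (hRl : 1 ≤ Rl) (hTl : 1 ≤ Tl) :
    Var[wilsonLoopObs (fun g : SUN N => (N : ℝ)⁻¹ * (g : Matrix (Fin N) (Fin N) ℂ).trace.re) (rectWalk x i j Rl Tl); μ] ≤
      2 * ((Rl : ℝ) + Tl) / ((N : ℝ) ^ 2 * (1 / 2 - 24 * b)) := by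
  have hN0 : (0 : ℝ) < N := by exact_mod_cast (show 0 < N by omega)
  have habs : |b| = b := abs_of_nonneg hb0
  have hden : 0 < 1 / 2 - 6 * b := by linarith
  have hc1 : 18 * b / (1 / 2 - 6 * b) < 1 := by rw [div_lt_one hden]; linarith
  have hK₀ : 0 < (N : ℝ) / 2 - N * |b| * (2 * (((4 : ℕ) : ℝ) - 1)) := by rw [habs]; push_cast; nlinarith
  have key := gibbs_variance_rectangle_le_of_oneLinkKRModulus (d := 4) (N := N) (by norm_num) (by omega) (β := b) (K := 1 / (1 / 2 - 6 * b))
    (by positivity) (R := 6 * b) (by rw [habs]; push_cast; linarith) (Balaban1983to89.StrongCouplingKernelWindow.oneLinkKRModulus_SU hN (by linarith))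
    (c := 18 * b / (1 / 2 - 6 * b)) (by rw [habs]; push_cast; exact le_of_eq (by field_simp; ring)) hc1 hK₀ hμ x hij hRl hTl
  have e : (1 - 18 * b / (1 / 2 - 6 * b)) * ((N : ℝ) / 2 - N * |b| * (2 * (((4 : ℕ) : ℝ) - 1))) = N * (1 / 2 - 24 * b) := by
    rw [habs]; push_cast
    rw [show (N : ℝ) / 2 - N * b * (2 * (4 - 1)) = N * (1 / 2 - 6 * b) by ring, sub_mul, one_mul, div_mul_eq_mul_div,
      show 18 * b * ((N : ℝ) * (1 / 2 - 6 * b)) = 18 * b * N * (1 / 2 - 6 * b) by ring, mul_div_assoc, div_self hden.ne', mul_one]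
    ring
  rw [e] at key
  refine key.trans (le_of_eq ?_)
  have h24 : (1 : ℝ) / 2 - 24 * b ≠ 0 := by
    have : (0 : ℝ) < 1 / 2 - 24 * b := by linarith
    exact this.ne'
  field_simp

end Cells

end Summit.Ventures.YMGap.RobustBall.LangevinPoincare

end
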